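import Summits.NavierStokesRegularity.NavierStokesRegularity.Theorems.OddMorawetzMorawetzKillsTypeIReduction
import Summits.NavierStokesRegularity.NavierStokesRegularity.Theorems.OddMorawetzLocal.Negative.OddMorawetzLocalB3Reduction
import Summits.NavierStokesRegularity.NavierStokesRegularity.Theorems.OddMorawetzOrderThreeIndefiniteFields
import Summits.NavierStokesRegularity.NavierStokesRegularity.Theorems.OddMorawetzMorawetzKillsTypeIIsotropicReduction
import Summits.NavierStokesRegularity.NavierStokesRegularity.Theorems.OddMorawetzMorawetzKillsTypeICubicJetExpansion
import Summits.NavierStokesRegularity.NavierStokesRegularity.Theorems.OddMorawetzMorawetzKillsTypeIInfinitesimalInvariance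
import Summits.NavierStokesRegularity.NavierStokesRegularity.Theorems.OddMorawetzMorawetzKillsTypeISignedPermBasis
import Summits.NavierStokesRegularity.NavierStokesRegularity.Theorems.OddMorawetzMorawetzKillsTypeIOrderThreeLive
import Summits.NavierStokesRegularity.NavierStokesRegularity.Theorems.OddMorawetzMorawetzKillsTypeINullTransfer
import Summits.NavierStokesRegularity.NavierStokesRegularity.Theorems.OddMorawetzMorawetzKillsTypeIJetCoordDefs
import Summits.NavierStokesRegularity.NavierStokesRegularity.Theorems.OddMorawetzMorawetzKillsTypeISymBasis
import Summits.NavierStokesRegularity.NavierStokesRegularity.Theorems.OddMorawetzMorawetzKillsTypeIJetCalculus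
import Summits.NavierStokesRegularity.NavierStokesRegularity.Theorems.OddMorawetzMorawetzKillsTypeIIsoAssembleThree
import Summits.NavierStokesRegularity.NavierStokesRegularity.Theorems.OddMorawetzMorawetzKillsTypeIKitSums
import Summits.NavierStokesRegularity.NavierStokesRegularity.Theorems.OddMorawetzMorawetzKillsTypeIKitSign
import Summits.NavierStokesRegularity.NavierStokesRegularity.Theorems.OddMorawetzMorawetzKillsTypeIKitPerm
import Summits.NavierStokesRegularity.NavierStokesRegularity.Theorems.OddMorawetzMorawetzKillsTypeIIsoStructureThree
import Summits.NavierStokesRegularity.NavierStokesRegularity.Theorems.OddMorawetzMorawetzKillsTypeIIsoNullThree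
import HarnessLib.Audit

/-!
# Skeleton (lead reshape r3, continuation lead c1) of the crux `OddMorawetz.MorawetzKillsTypeI`

(crux item `stmt-NavierStokesRegularity-1377`, route `route-NavierStokesRegularity-OddMorawetz`, line `birth` =
payload slug `registered`; lead `prover-line-stmt-NavierStokesRegularity-1377-c1-0`, 2026-08-17.)

THE CRUX. For every admissible local density `(k, m)` (`k ≤ 5`, smooth, pointwise cubic, derivative weight `k`)
carrying a MORAWETZ CERTIFICATE (`Q_m ≥ 0` on divergence-free Schwartz fields, `> 0` once), Type-I blow-up is
excluded. After r1/r2 (previous lead, all LANDED): even `k` by parity, `k = 1` by hyperoctahedral averaging, hence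
`morawetzKillsTypeI_of_no_certificate_ge_three` (p153801): the crux follows from "no certificate at odd `3 ≤ k ≤ 5`",
i.e. at `k ∈ {3, 5}` — the residue `stub_captureHigh` of r2, handed back as crux-sized.

THE CUT (r3): ISOTROPY. A certificate averages over the compact group `O(3)` to an `O(3)`-INVARIANT certificate
(`stub_isotropicReduction`: Haar probability on `Matrix.unitaryGroup (Fin 3) ℝ`, the average of the trilinear form
`D³m(0)` as a Bochner integral, `Q` of the average = Haar average of `Q` over rotated fields by Fubini and the landed
rotation covariance `morawetzQ_rotate` / `stub_rotate_eulerBilinear`; nonnegativity termwise, strictness by continuity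
in the group variable and positivity of Haar measure on open sets). Invariant weight-`k` cubic forms on symmetric
3-jets are spanned by `δ`-contractions: 17 at `k = 3`, 50 at `k = 5`; on divergence-free jets 8 and 22; modulo total
divergences (null Lagrangians) ONE live class at `k = 3` — the enstrophy-production density `R = ω·(∇u)ω`, which takes
both signs by the landed `OrderThreeIndefinite` values — and TWO at `k = 5` (exact engine `compute/jetalg.py` of the
lead; the 1376 leads' independent numbers agree). So `stub_isoWeight` (no invariant certificate at `k ∈ {3,5}`) is a
finite linear-algebra statement; its generic ingredients are registered as separate worker stubs:
`stub_cubicJetExpansion` (coordinates of multilinear maps on basis jets; weight-block decomposition of `D³m(0)`),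
`stub_infinitesimalInvariance` (invariance under all isometries ⇒ the tensor equations of `D³m(0)` for the three
rotation generators), `stub_signedPermBasis` (the hyperoctahedral group on basis jets: signs and index permutations),
`stub_orderThreeLive` (the live weight-3 class takes both signs: bookkeeping onto `PM_value` / `PP_value`),
`stub_nullTransfer` (a density that is a total divergence on divergence-free jets has `Q ≡ 0`: polarisation along
`B(v,v)` + the landed `stub_fluxTransfer` / `stub_jetDecay`).

`MorawetzKillsTypeI_of` is the REAL composition: `morawetzKillsTypeI_of_no_certificate_ge_three` fed with
`stub_isotropicReduction` and `stub_isoWeight` (closed modulo those two stubs; the other five stubs are the registered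
ingredients of `stub_isoWeight`).

Disproof used: none on file (`ledger crux ls stmt-NavierStokesRegularity-1377`: Lines/birth.*, PICKED.md, COORD-*.md; no
`Disproof.lean`, no `Theorems/MorawetzKillsTypeI/Negative/`), 2026-08-17T11:40Z.
-/

noncomputable section

open Set MeasureTheory Filter Topology
open scoped RealInnerProductSpace

namespace Summit.NavierStokesRegularity.NavierStokesRegularity.Cruxes.MorawetzKillsTypeI.Birth

open Summit.NavierStokesRegularity.NavierStokesRegularity.Theorems.OddMorawetz (Jet3 jetAct mlAct signedPerm E3 P3 pgv jbsum jbasis jcU jcA jcH jcT jshift)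

set_option linter.unusedVariables false
set_option linter.dupNamespace false

/-! ### Stubs -/

/-- **stub — `stub_isotropicReduction` (L; lead).** A Morawetz certificate `(k, m)` (smooth, pointwise cubic,
derivative weight `k`, `Q_m ≥ 0` on divergence-free Schwartz fields and `> 0` once — the crux's clauses with its own
`let J` / `let Q`) yields an `O(3)`-INVARIANT certificate `(k, m̄)`: `m̄ (jetAct g z) = m̄ z` for every linear
isometry `g` of `ℝ³`. Construction: Haar average over `Matrix.unitaryGroup (Fin 3) ℝ` of the trilinear form `D³m(0)`
transported by `jetAct`; `Q_{m̄}(v) = ∫ Q_m(g⁻¹·v) dg` (Fubini + `morawetzQ_rotate`), `≥ 0` termwise, `> 0` at the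
strict witness by continuity in `g` and positivity of Haar measure on open sets. -/
theorem stub_isotropicReduction :
    ∀ (k : ℕ) (m : Jet3 → ℝ),
      let J := fun (v : E3 → E3) (x : E3) => ((v x, iteratedFDeriv ℝ 1 v x, iteratedFDeriv ℝ 2 v x, iteratedFDeriv ℝ 3 v x) : Jet3);
      let Q := fun (m : Jet3 → ℝ) (v : E3 → E3) =>
        -∫ x, fderiv ℝ m (J v x) (J (Literature.Analysis.FluidPDE.eulerBilinear v v) x);
      ContDiff ℝ (⊤ : ℕ∞) m → (∀ (μ : ℝ) z, m (μ • z) = μ ^ 3 * m z) →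
      (∀ (s : ℝ), 0 < s → ∀ (z₀ : E3) (z₁ : E3 [×1]→L[ℝ] E3) (z₂ : E3 [×2]→L[ℝ] E3) (z₃ : E3 [×3]→L[ℝ] E3),
          m (z₀, s • z₁, (s ^ 2) • z₂, (s ^ 3) • z₃) = s ^ k * m (z₀, z₁, z₂, z₃)) →
      (∀ v, Literature.Analysis.FluidPDE.IsSchwartzField v →
          Literature.Analysis.FluidPDE.VectorCalculus.IsDivFree v → 0 ≤ Q m v) →
      (∃ v, Literature.Analysis.FluidPDE.IsSchwartzField v ∧
          Literature.Analysis.FluidPDE.VectorCalculus.IsDivFree v ∧ 0 < Q m v) →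
      ∃ m' : Jet3 → ℝ, ContDiff ℝ (⊤ : ℕ∞) m' ∧ (∀ (μ : ℝ) z, m' (μ • z) = μ ^ 3 * m' z) ∧
        (∀ (s : ℝ), 0 < s → ∀ (z₀ : E3) (z₁ : E3 [×1]→L[ℝ] E3) (z₂ : E3 [×2]→L[ℝ] E3) (z₃ : E3 [×3]→L[ℝ] E3),
          m' (z₀, s • z₁, (s ^ 2) • z₂, (s ^ 3) • z₃) = s ^ k * m' (z₀, z₁, z₂, z₃)) ∧
        (∀ (g : E3 ≃ₗᵢ[ℝ] E3) (z : Jet3), m' (jetAct g z) = m' z) ∧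
        (∀ v, Literature.Analysis.FluidPDE.IsSchwartzField v →
          Literature.Analysis.FluidPDE.VectorCalculus.IsDivFree v → 0 ≤ Q m' v) ∧
        (∃ v, Literature.Analysis.FluidPDE.IsSchwartzField v ∧
          Literature.Analysis.FluidPDE.VectorCalculus.IsDivFree v ∧ 0 < Q m' v) :=
  Theorems.stub_isotropicReduction

/-- **stub — `stub_isoReduceFive` (XL; generated linear algebra — the k = 5 reduction).** For every smooth,
pointwise cubic, derivative-weight-5, isometry-invariant density `m`, the Euler pairing `Q m` is, on divergence-free
Schwartz fields, a FIXED combination of the Euler pairings of the two live weight-5 contractions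
`L₁ = ∑ u_a ∂_b∂_c u_a ∂_cΔu_b` and `L₂ = ∑ u_a ∂_a∂_c u_b ∂_cΔu_b`: by the exact engine (`compute/k5emit.py`, data
`k5_data.json`) an invariant weight-5 form on symmetric jets is a combination of 50 `δ`-contractions (`so(3)` +
hyperoctahedral linear algebra, as in the landed weight-3 structure theorem), which on divergence-free jets reduce to
22 classes, 20 of them total divergences of explicit cubic weight-4 fluxes of the 2-jet (null by
`IsoNullThree.integral_zero_of_flux`), the quotient being spanned by `L₁, L₂` (indices 1 and 4 of the engine's basis). -/
theorem stub_isoReduceFive :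
    let e : Fin 3 → E3 := fun i => EuclideanSpace.single i (1 : ℝ);
    let L₁ : Jet3 → ℝ := fun z => ∑ i0 : Fin 3, ∑ i1 : Fin 3, ∑ i2 : Fin 3, ∑ i3 : Fin 3, z.1 i0 * z.2.2.1 ![e i1, e i2] i0 * z.2.2.2 ![e i2, e i3, e i3] i1;
    let L₂ : Jet3 → ℝ := fun z => ∑ i0 : Fin 3, ∑ i1 : Fin 3, ∑ i2 : Fin 3, ∑ i3 : Fin 3, z.1 i0 * z.2.2.1 ![e i0, e i2] i1 * z.2.2.2 ![e i2, e i3, e i3] i1;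
    let J := fun (v : E3 → E3) (x : E3) => ((v x, iteratedFDeriv ℝ 1 v x, iteratedFDeriv ℝ 2 v x, iteratedFDeriv ℝ 3 v x) : Jet3);
    let Q := fun (m : Jet3 → ℝ) (v : E3 → E3) =>
      -∫ x, fderiv ℝ m (J v x) (J (Literature.Analysis.FluidPDE.eulerBilinear v v) x);
    ∀ (m : Jet3 → ℝ), ContDiff ℝ (⊤ : ℕ∞) m → (∀ (μ : ℝ) z, m (μ • z) = μ ^ 3 * m z) →
      (∀ (s : ℝ), 0 < s → ∀ (z₀ : E3) (z₁ : E3 [×1]→L[ℝ] E3) (z₂ : E3 [×2]→L[ℝ] E3) (z₃ : E3 [×3]→L[ℝ] E3),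
          m (z₀, s • z₁, (s ^ 2) • z₂, (s ^ 3) • z₃) = s ^ 5 * m (z₀, z₁, z₂, z₃)) →
      (∀ (g : E3 ≃ₗᵢ[ℝ] E3) (z : Jet3), m (jetAct g z) = m z) →
      ∃ c₁ c₂ : ℝ, ∀ v, Literature.Analysis.FluidPDE.IsSchwartzField v →
        Literature.Analysis.FluidPDE.VectorCalculus.IsDivFree v → Q m v = c₁ * Q L₁ v + c₂ * Q L₂ v := by
  sorry

/-- **stub — `stub_isoLiveFive` (XL; exact values — the k = 5 live computation).** The two live weight-5 classes are
JOINTLY sign-indefinite (Stiemke form): a combination `c₁ Q L₁ + c₂ Q L₂` that is `≥ 0` on every divergence-free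
Schwartz field vanishes on all of them. Mechanism: exact values of `(Q L₁, Q L₂)` on finitely many explicit
polynomial-Gaussian divergence-free fields whose value vectors positively span `ℝ²` (the weight-5 analogue of the
`OrderThreeIndefinite` computation: integration by parts to `∫ ⟪B(v,v), G⟫`, Leray duality
`∫⟪P W, G⟫ = ∫⟪W,G⟫ − (4π²)⁻¹ Re ∫ 𝓕div W conj 𝓕div G/|ξ|²`, Hermite/Gaussian moments). -/
theorem stub_isoLiveFive :
    let e : Fin 3 → E3 := fun i => EuclideanSpace.single i (1 : ℝ);
    let L₁ : Jet3 → ℝ := fun z => ∑ i0 : Fin 3, ∑ i1 : Fin 3, ∑ i2 : Fin 3, ∑ i3 : Fin 3, z.1 i0 * z.2.2.1 ![e i1, e i2] i0 * z.2.2.2 ![e i2, e i3, e i3] i1;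
    let L₂ : Jet3 → ℝ := fun z => ∑ i0 : Fin 3, ∑ i1 : Fin 3, ∑ i2 : Fin 3, ∑ i3 : Fin 3, z.1 i0 * z.2.2.1 ![e i0, e i2] i1 * z.2.2.2 ![e i2, e i3, e i3] i1;
    let J := fun (v : E3 → E3) (x : E3) => ((v x, iteratedFDeriv ℝ 1 v x, iteratedFDeriv ℝ 2 v x, iteratedFDeriv ℝ 3 v x) : Jet3);
    let Q := fun (m : Jet3 → ℝ) (v : E3 → E3) =>
      -∫ x, fderiv ℝ m (J v x) (J (Literature.Analysis.FluidPDE.eulerBilinear v v) x);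
    ∀ c₁ c₂ : ℝ,
      (∀ v, Literature.Analysis.FluidPDE.IsSchwartzField v →
        Literature.Analysis.FluidPDE.VectorCalculus.IsDivFree v → 0 ≤ c₁ * Q L₁ v + c₂ * Q L₂ v) →
      ∀ v, Literature.Analysis.FluidPDE.IsSchwartzField v →
        Literature.Analysis.FluidPDE.VectorCalculus.IsDivFree v → c₁ * Q L₁ v + c₂ * Q L₂ v = 0 := by
  sorry

/-- **`stub_isoWeightFive` (the k = 5 residue; CLOSED modulo `stub_isoReduceFive` + `stub_isoLiveFive`).** NO
`O(3)`-invariant Morawetz certificate of derivative weight `5`: by the reduction its Euler pairing is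
`c₁ Q L₁ + c₂ Q L₂`, nonnegative by hypothesis, hence identically zero by the live computation — contradicting
strictness. -/
theorem stub_isoWeightFive :
    ∀ (m : Jet3 → ℝ),
      let J := fun (v : E3 → E3) (x : E3) => ((v x, iteratedFDeriv ℝ 1 v x, iteratedFDeriv ℝ 2 v x, iteratedFDeriv ℝ 3 v x) : Jet3);
      let Q := fun (m : Jet3 → ℝ) (v : E3 → E3) =>
        -∫ x, fderiv ℝ m (J v x) (J (Literature.Analysis.FluidPDE.eulerBilinear v v) x);
      ContDiff ℝ (⊤ : ℕ∞) m → (∀ (μ : ℝ) z, m (μ • z) = μ ^ 3 * m z) →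
      (∀ (s : ℝ), 0 < s → ∀ (z₀ : E3) (z₁ : E3 [×1]→L[ℝ] E3) (z₂ : E3 [×2]→L[ℝ] E3) (z₃ : E3 [×3]→L[ℝ] E3),
          m (z₀, s • z₁, (s ^ 2) • z₂, (s ^ 3) • z₃) = s ^ 5 * m (z₀, z₁, z₂, z₃)) →
      (∀ (g : E3 ≃ₗᵢ[ℝ] E3) (z : Jet3), m (jetAct g z) = m z) →
      (∀ v, Literature.Analysis.FluidPDE.IsSchwartzField v →
          Literature.Analysis.FluidPDE.VectorCalculus.IsDivFree v → 0 ≤ Q m v) →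
      (∃ v, Literature.Analysis.FluidPDE.IsSchwartzField v ∧
          Literature.Analysis.FluidPDE.VectorCalculus.IsDivFree v ∧ 0 < Q m v) → False := by
  intro m J Q hm hcub hwt hinv hQ hpos
  obtain ⟨v₀, hv₀, hd₀, hpos₀⟩ := hpos
  obtain ⟨c₁, c₂, hc⟩ := stub_isoReduceFive m hm hcub hwt hinv
  have hz := stub_isoLiveFive c₁ c₂ (fun v hv hd => le_of_le_of_eq (hQ v hv hd) (hc v hv hd)) v₀ hv₀ hd₀
  have h0 : Q m v₀ = 0 := (hc v₀ hv₀ hd₀).trans hz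
  exact absurd h0 (ne_of_gt hpos₀)

/-- **stub — `stub_cubicJetExpansion` (M; worker). Coordinates.** (i) Every continuous `n`-multilinear map
`Z : ℝ³ × ⋯ × ℝ³ → ℝ³` is the finite combination of the basis maps `h ↦ (∏ₛ h_s (j s)) eᵢ` with coefficients its
values on basis vectors, `(Z (e_{j 0}, …, e_{j (n-1)}))ᵢ`. (ii) A symmetric continuous trilinear form on 3-jets which
scales with weight `k` under the jet dilation `(z₀, s z₁, s² z₂, s³ z₃)` (`s > 0`) vanishes on pure-order triples of the
wrong total order, so on the diagonal it is the sum of its weight-`k` blocks: for `k = 3` the blocks `(0,0,3)`, `(0,1,2)`,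
`(1,1,1)` with multiplicities `3, 6, 1`, for `k = 5` the blocks `(0,2,3)`, `(1,1,3)`, `(1,2,2)` with `6, 3, 3`. -/
theorem stub_cubicJetExpansion :
    (∀ (n : ℕ) (Z : E3 [×n]→L[ℝ] E3),
      Z = ∑ i : Fin 3, ∑ j : Fin n → Fin 3,
        (Z (fun s => EuclideanSpace.single (j s) (1 : ℝ)) i) •
          (ContinuousMultilinearMap.mkPiRing ℝ (Fin n) (EuclideanSpace.single i (1 : ℝ))).compContinuousLinearMap
            (fun s => EuclideanSpace.proj (j s))) ∧
    (∀ (k : ℕ) (D : Jet3 [×3]→L[ℝ] ℝ),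
      (∀ (x : Fin 3 → Jet3) (σ : Equiv.Perm (Fin 3)), D (x ∘ σ) = D x) →
      (∀ (s : ℝ), 0 < s → ∀ z : Jet3,
        D (fun _ => ((z.1, s • z.2.1, (s ^ 2) • z.2.2.1, (s ^ 3) • z.2.2.2) : Jet3)) = s ^ k * D (fun _ => z)) →
      ((k = 3 → ∀ z : Jet3, D (fun _ => z) =
          3 * D ![((z.1, 0, 0, 0) : Jet3), ((z.1, 0, 0, 0) : Jet3), ((0, 0, 0, z.2.2.2) : Jet3)] +
          6 * D ![((z.1, 0, 0, 0) : Jet3), ((0, z.2.1, 0, 0) : Jet3), ((0, 0, z.2.2.1, 0) : Jet3)] +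
          D ![((0, z.2.1, 0, 0) : Jet3), ((0, z.2.1, 0, 0) : Jet3), ((0, z.2.1, 0, 0) : Jet3)]) ∧
       (k = 5 → ∀ z : Jet3, D (fun _ => z) =
          6 * D ![((z.1, 0, 0, 0) : Jet3), ((0, 0, z.2.2.1, 0) : Jet3), ((0, 0, 0, z.2.2.2) : Jet3)] +
          3 * D ![((0, z.2.1, 0, 0) : Jet3), ((0, z.2.1, 0, 0) : Jet3), ((0, 0, 0, z.2.2.2) : Jet3)] +
          3 * D ![((0, z.2.1, 0, 0) : Jet3), ((0, 0, z.2.2.1, 0) : Jet3), ((0, 0, z.2.2.1, 0) : Jet3)]))) :=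
  Theorems.stub_cubicJetExpansion

/-- **stub — `stub_infinitesimalInvariance` (L; worker). The tensor equations.** If a smooth density on 3-jets is
invariant under every linear isometry of `ℝ³` (acting by `jetAct`), then its third derivative at the origin is
annihilated by the three rotation generators acting as derivations: `D(ℓₐx, y, w) + D(x, ℓₐy, w) + D(x, y, ℓₐw) = 0`,
where `Lₐ` is the rotation generator about the axis `eₐ` (the matrix `-ε_{a··}`) and `ℓₐ` its induced derivation on
jets, `ℓₐ(z₀, z₁, z₂, z₃) = (Lₐz₀, Lₐ∘z₁ − z₁∘Lₐ, Lₐ∘z₂ − z₂∘(Lₐ,1) − z₂∘(1,Lₐ), …)` (derivative at `θ = 0` of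
`jetAct` of the rotation by `θ` about `eₐ`). -/
theorem stub_infinitesimalInvariance :
    ∀ (m : Jet3 → ℝ), ContDiff ℝ (⊤ : ℕ∞) m → (∀ (g : E3 ≃ₗᵢ[ℝ] E3) (z : Jet3), m (jetAct g z) = m z) →
      ∀ (a : Fin 3),
      let L : E3 →L[ℝ] E3 := Matrix.toEuclideanCLM (n := Fin 3) (𝕜 := ℝ)
        (![!![0, 0, 0; 0, 0, -1; 0, 1, 0], !![0, 0, 1; 0, 0, 0; -1, 0, 0], !![0, -1, 0; 1, 0, 0; 0, 0, 0]] a);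
      let ℓ : Jet3 → Jet3 := fun z =>
        (L z.1,
          L.compContinuousMultilinearMap z.2.1 -
            ∑ s : Fin 1, z.2.1.compContinuousLinearMap (Function.update (fun _ => ContinuousLinearMap.id ℝ E3) s L),
          L.compContinuousMultilinearMap z.2.2.1 -
            ∑ s : Fin 2, z.2.2.1.compContinuousLinearMap (Function.update (fun _ => ContinuousLinearMap.id ℝ E3) s L),
          L.compContinuousMultilinearMap z.2.2.2 -
            ∑ s : Fin 3, z.2.2.2.compContinuousLinearMap (Function.update (fun _ => ContinuousLinearMap.id ℝ E3) s L));
      ∀ (x y w : Jet3),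
        iteratedFDeriv ℝ 3 m 0 ![ℓ x, y, w] + iteratedFDeriv ℝ 3 m 0 ![x, ℓ y, w] +
          iteratedFDeriv ℝ 3 m 0 ![x, y, ℓ w] = 0 :=
  Theorems.stub_infinitesimalInvariance

/-- **stub — `stub_signedPermBasis` (M; worker). The hyperoctahedral group on basis jets.** (i) The third derivative
at `0` of a smooth density invariant under every linear isometry is invariant under the simultaneous jet action;
(ii) a signed coordinate permutation `g = (σ, ε)` maps the basis vector `eᵢ` to `ε(σ i) e_{σ i}` and (iii) the basis
multilinear map `h ↦ (∏ₛ h_s (j s)) eᵢ` to `± (∏…) e_{σ i}` with indices `σ ∘ j` and the sign `ε(σ i) ∏ₛ ε(σ (j s))`. -/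
theorem stub_signedPermBasis :
    (∀ (m : Jet3 → ℝ), ContDiff ℝ (⊤ : ℕ∞) m → (∀ (g : E3 ≃ₗᵢ[ℝ] E3) (z : Jet3), m (jetAct g z) = m z) →
      ∀ (g : E3 ≃ₗᵢ[ℝ] E3) (x : Fin 3 → Jet3),
        iteratedFDeriv ℝ 3 m 0 (fun s => jetAct g (x s)) = iteratedFDeriv ℝ 3 m 0 x) ∧
    (∀ (σ : Equiv.Perm (Fin 3)) (ε : Fin 3 → ℤˣ) (i : Fin 3),
      signedPerm σ ε (EuclideanSpace.single i (1 : ℝ)) = ((ε (σ i) : ℤ) : ℝ) • EuclideanSpace.single (σ i) (1 : ℝ)) ∧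
    (∀ (σ : Equiv.Perm (Fin 3)) (ε : Fin 3 → ℤˣ) (n : ℕ) (i : Fin 3) (j : Fin n → Fin 3),
      mlAct (signedPerm σ ε) n
          ((ContinuousMultilinearMap.mkPiRing ℝ (Fin n) (EuclideanSpace.single i (1 : ℝ))).compContinuousLinearMap
            (fun s => EuclideanSpace.proj (j s))) =
        (((ε (σ i) : ℤ) : ℝ) * ∏ s, ((ε (σ (j s)) : ℤ) : ℝ)) •
          (ContinuousMultilinearMap.mkPiRing ℝ (Fin n) (EuclideanSpace.single (σ i) (1 : ℝ))).compContinuousLinearMap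
            (fun s => EuclideanSpace.proj (σ (j s)))) :=
  Theorems.stub_signedPermBasis

/-- **stub — `stub_orderThreeLive` (M; worker). The live weight-3 class takes both signs.** For the
enstrophy-production density `r(z) = ⟪ω(z₁), z₁ ω(z₁)⟫` (`ω(A) = (A₂₁−A₁₂, A₀₂−A₂₀, A₁₀−A₀₁)`, `Aᵢⱼ = (z₁ eⱼ)ᵢ`, so
`r(Jv) = ω·(∇v)ω`), the Euler derivative `Q_r(v) = -∫ Dr(Jv)[J B(v,v)]` is the `OrderThreeIndefinite` form
`-∫(⟪curl b, Dv ω⟫ + ⟪ω, Db ω⟫ + ⟪ω, Dv curl b⟫)`, hence `< 0` on the Gaussian vortex `v₋` and `> 0` on the planar field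
`v₊` of `OddMorawetzOrderThreeIndefiniteFields` (`PM_value`, `PP_value`). -/
theorem stub_orderThreeLive :
    let e : Fin 3 → E3 := fun i => EuclideanSpace.single i (1 : ℝ);
    let ω : (E3 [×1]→L[ℝ] E3) → E3 := fun A =>
      WithLp.toLp 2 ![A (fun _ => e 1) 2 - A (fun _ => e 2) 1, A (fun _ => e 2) 0 - A (fun _ => e 0) 2,
        A (fun _ => e 0) 1 - A (fun _ => e 1) 0];
    let r : Jet3 → ℝ := fun z => inner ℝ (ω z.2.1) (z.2.1 (fun _ => ω z.2.1));
    let J := fun (v : E3 → E3) (x : E3) => ((v x, iteratedFDeriv ℝ 1 v x, iteratedFDeriv ℝ 2 v x, iteratedFDeriv ℝ 3 v x) : Jet3);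
    let Q := fun (v : E3 → E3) => -∫ x, fderiv ℝ r (J v x) (J (Literature.Analysis.FluidPDE.eulerBilinear v v) x);
    ContDiff ℝ (⊤ : ℕ∞) r ∧
    (∃ v, Literature.Analysis.FluidPDE.IsSchwartzField v ∧ Literature.Analysis.FluidPDE.VectorCalculus.IsDivFree v ∧
        Q v < 0) ∧
    (∃ v, Literature.Analysis.FluidPDE.IsSchwartzField v ∧ Literature.Analysis.FluidPDE.VectorCalculus.IsDivFree v ∧
        0 < Q v) :=
  Theorems.stub_orderThreeLive

/-- **stub — `stub_nullTransfer` (M/L; worker). Total divergences have vanishing Euler derivative.** If a smooth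
density `n` on 3-jets is, along every smooth divergence-free field `w`, the divergence of a smooth flux of the 3-jet,
`n(Jw x) = div_x F(Jw ·)(x)`, then `∫ Dn(Jv)[J B(v,v)] = 0` for every divergence-free Schwartz `v`: polarise the
identity along `w_t = v + t B(v,v)` (`B(v,v)` is smooth and divergence free: `contDiff_eulerBilinear_holds`,
`stub_divFree_eulerBilinear`), differentiate at `t = 0`, and integrate with the landed `stub_fluxTransfer` (σ = 0; decay
from `stub_jetDecay`). -/
theorem stub_nullTransfer :
    ∀ (n : Jet3 → ℝ) (F : Jet3 → E3),
      let J := fun (v : E3 → E3) (x : E3) => ((v x, iteratedFDeriv ℝ 1 v x, iteratedFDeriv ℝ 2 v x, iteratedFDeriv ℝ 3 v x) : Jet3);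
      ContDiff ℝ (⊤ : ℕ∞) n → ContDiff ℝ (⊤ : ℕ∞) F →
      (∀ w : E3 → E3, ContDiff ℝ (⊤ : ℕ∞) w → Literature.Analysis.FluidPDE.VectorCalculus.IsDivFree w →
        ∀ x, n (J w x) = Literature.Analysis.FluidPDE.VectorCalculus.divergence (fun y => F (J w y)) x) →
      ∀ v, Literature.Analysis.FluidPDE.IsSchwartzField v → Literature.Analysis.FluidPDE.VectorCalculus.IsDivFree v →
        ∫ x, fderiv ℝ n (J v x) (J (Literature.Analysis.FluidPDE.eulerBilinear v v) x) = 0 :=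
  Theorems.stub_nullTransfer


/-- **stub — `stub_symBasis` (M; worker). Symmetrised basis maps.** With `B n c J : h ↦ (∏ₛ h_s (J s)) e_c` the basis
`n`-multilinear maps and `S n c J = ∑_{π ∈ 𝔖ₙ} B n c (J ∘ π)` their un-normalised symmetrisations: (L1) `S` is
reordering invariant; (L2) a SYMMETRIC `n`-multilinear map expands as `Z = ∑_c ∑_J ((Z (e ∘ J))_c / n!) • S n c J`;
(L3) the hyperoctahedral group acts on `S n c J` by a sign and the index permutation; (L4) every linear `L : ℝ³ → ℝ³`
acts on `S n c J` as a derivation (`L ∘ Z − ∑ₛ Z ∘ₛ L`) by the explicit matrix formula (the infinitesimal rotations of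
`stub_infinitesimalInvariance` are used through it). -/
theorem stub_symBasis :
    let e : Fin 3 → E3 := fun i => EuclideanSpace.single i (1 : ℝ);
    let B := fun (n : ℕ) (c : Fin 3) (J : Fin n → Fin 3) =>
      (ContinuousMultilinearMap.mkPiRing ℝ (Fin n) (e c)).compContinuousLinearMap
        (fun s => (EuclideanSpace.proj (J s) : E3 →L[ℝ] ℝ));
    let S := fun (n : ℕ) (c : Fin 3) (J : Fin n → Fin 3) => ∑ π : Equiv.Perm (Fin n), B n c (J ∘ π);
    (∀ (n : ℕ) (c : Fin 3) (J : Fin n → Fin 3) (σ : Equiv.Perm (Fin n)), S n c (J ∘ σ) = S n c J) ∧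
    (∀ (n : ℕ) (Z : E3 [×n]→L[ℝ] E3), (∀ (h : Fin n → E3) (σ : Equiv.Perm (Fin n)), Z (h ∘ σ) = Z h) →
      Z = ∑ c : Fin 3, ∑ J : Fin n → Fin 3, ((Z (fun s => e (J s)) c) / (n.factorial : ℝ)) • S n c J) ∧
    (∀ (σ : Equiv.Perm (Fin 3)) (ε : Fin 3 → ℤˣ) (n : ℕ) (c : Fin 3) (J : Fin n → Fin 3),
      mlAct (signedPerm σ ε) n (S n c J) =
        (((ε (σ c) : ℤ) : ℝ) * ∏ s, ((ε (σ (J s)) : ℤ) : ℝ)) • S n (σ c) (σ ∘ J)) ∧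
    (∀ (L : E3 →L[ℝ] E3) (n : ℕ) (c : Fin 3) (J : Fin n → Fin 3),
      L.compContinuousMultilinearMap (S n c J) -
          ∑ s : Fin n, (S n c J).compContinuousLinearMap (Function.update (fun _ => ContinuousLinearMap.id ℝ E3) s L) =
        ∑ c' : Fin 3, (L (e c) c') • S n c' J -
          ∑ s : Fin n, ∑ j' : Fin 3, (L (e j') (J s)) • S n c (Function.update J s j')) :=
  Theorems.stub_symBasis

/-- **stub — `stub_jetCalculus` (M/L; worker). Jets of smooth fields in coordinates.** (a) divergence-free fields have
trace-free jets at orders 1, 2, 3; (b) the divergence of a flux of the 3-jet is the trace of the chain rule;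
(c) the derivative of the 3-jet map along `eᵢ` has first three components `(Dw eᵢ, D²w(eᵢ,·), D³w(eᵢ,·,·))` (Mathlib
`fderiv_iteratedFDeriv`); (d) a flux that ignores the top jet component has a derivative that ignores it; (e) two
differentiable densities that agree on the symmetric jets have the same derivative there along symmetric directions;
(f) jets of smooth fields are symmetric. -/
theorem stub_jetCalculus :
    let e : Fin 3 → E3 := fun i => EuclideanSpace.single i (1 : ℝ);
    let Symm : Jet3 → Prop := fun z =>
      (∀ (h : Fin 2 → E3) (σ : Equiv.Perm (Fin 2)), z.2.2.1 (h ∘ σ) = z.2.2.1 h) ∧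
      (∀ (h : Fin 3 → E3) (σ : Equiv.Perm (Fin 3)), z.2.2.2 (h ∘ σ) = z.2.2.2 h);
    let J := fun (v : E3 → E3) (x : E3) => ((v x, iteratedFDeriv ℝ 1 v x, iteratedFDeriv ℝ 2 v x, iteratedFDeriv ℝ 3 v x) : Jet3);
    (∀ w : E3 → E3, ContDiff ℝ (⊤ : ℕ∞) w → Literature.Analysis.FluidPDE.VectorCalculus.IsDivFree w → ∀ x : E3,
      (∑ i : Fin 3, iteratedFDeriv ℝ 1 w x (fun _ => e i) i = 0) ∧
      (∀ j : Fin 3, ∑ i : Fin 3, iteratedFDeriv ℝ 2 w x ![e i, e j] i = 0) ∧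
      (∀ j k : Fin 3, ∑ i : Fin 3, iteratedFDeriv ℝ 3 w x ![e i, e j, e k] i = 0)) ∧
    (∀ (F : Jet3 → E3) (w : E3 → E3), ContDiff ℝ 1 F → ContDiff ℝ (⊤ : ℕ∞) w → ∀ x : E3,
      Literature.Analysis.FluidPDE.VectorCalculus.divergence (fun y => F (J w y)) x =
        ∑ i : Fin 3, fderiv ℝ F (J w x) (fderiv ℝ (fun y => J w y) x (e i)) i) ∧
    (∀ (w : E3 → E3), ContDiff ℝ (⊤ : ℕ∞) w → ∀ (x : E3) (i : Fin 3),
      (fderiv ℝ (fun y => J w y) x (e i)).1 = (J w x).2.1 (fun _ => e i) ∧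
      (fderiv ℝ (fun y => J w y) x (e i)).2.1 = (J w x).2.2.1.curryLeft (e i) ∧
      (fderiv ℝ (fun y => J w y) x (e i)).2.2.1 = (J w x).2.2.2.curryLeft (e i)) ∧
    (∀ (F : Jet3 → E3), Differentiable ℝ F →
      (∀ (z : Jet3) (t : E3 [×3]→L[ℝ] E3), F (z.1, z.2.1, z.2.2.1, t) = F (z.1, z.2.1, z.2.2.1, 0)) →
      ∀ (z w w' : Jet3), w.1 = w'.1 → w.2.1 = w'.2.1 → w.2.2.1 = w'.2.2.1 → fderiv ℝ F z w = fderiv ℝ F z w') ∧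
    (∀ (m₁ m₂ : Jet3 → ℝ), Differentiable ℝ m₁ → Differentiable ℝ m₂ → (∀ z, Symm z → m₁ z = m₂ z) →
      ∀ (z w : Jet3), Symm z → Symm w → fderiv ℝ m₁ z w = fderiv ℝ m₂ z w) ∧
    (∀ (w : E3 → E3), ContDiff ℝ (⊤ : ℕ∞) w → ∀ x : E3, Symm (J w x)) :=
  Theorems.stub_jetCalculus

/-- **stub — `stub_isoStructureThree` (L; lead, generated linear algebra). Invariant weight-3 cubic forms.** A smooth,
pointwise cubic, derivative-weight-3 density on 3-jets which is invariant under every linear isometry is, on SYMMETRIC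
jets, a real combination of the 17 `δ`-contractions `I0 … I16` (u u T, u A H and A A A types; exact engine
`compute/jetalg.py`). Proof: coordinates (`stub_cubicJetExpansion`, `stub_symBasis`), hyperoctahedral sign/orbit
relations (`stub_signedPermBasis`), the `so(3)` tensor equations (`stub_infinitesimalInvariance`) and a rational
certificate. -/
theorem stub_isoStructureThree :
    let e : Fin 3 → E3 := fun i => EuclideanSpace.single i (1 : ℝ);
    let ω : (E3 [×1]→L[ℝ] E3) → E3 := fun A =>
      WithLp.toLp 2 ![A (fun _ => e 1) 2 - A (fun _ => e 2) 1, A (fun _ => e 2) 0 - A (fun _ => e 0) 2,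
        A (fun _ => e 0) 1 - A (fun _ => e 1) 0];
    let r : Jet3 → ℝ := fun z => inner ℝ (ω z.2.1) (z.2.1 (fun _ => ω z.2.1));
    let I0 : Jet3 → ℝ := fun z => ∑ i0 : Fin 3, ∑ i1 : Fin 3, ∑ i2 : Fin 3, z.1 i0 * z.1 i0 * z.2.2.2 ![e i1, e i2, e i2] i1;
    let I1 : Jet3 → ℝ := fun z => ∑ i0 : Fin 3, ∑ i1 : Fin 3, ∑ i2 : Fin 3, z.1 i0 * z.1 i1 * z.2.2.2 ![e i1, e i2, e i2] i0;
    let I2 : Jet3 → ℝ := fun z => ∑ i0 : Fin 3, ∑ i1 : Fin 3, ∑ i2 : Fin 3, z.1 i0 * z.1 i1 * z.2.2.2 ![e i0, e i1, e i2] i2;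
    let I3 : Jet3 → ℝ := fun z => ∑ i0 : Fin 3, ∑ i1 : Fin 3, ∑ i2 : Fin 3, z.1 i0 * z.2.1 (fun _ => e i1) i0 * z.2.2.1 ![e i2, e i2] i1;
    let I4 : Jet3 → ℝ := fun z => ∑ i0 : Fin 3, ∑ i1 : Fin 3, ∑ i2 : Fin 3, z.1 i0 * z.2.1 (fun _ => e i1) i0 * z.2.2.1 ![e i1, e i2] i2;
    let I5 : Jet3 → ℝ := fun z => ∑ i0 : Fin 3, ∑ i1 : Fin 3, ∑ i2 : Fin 3, z.1 i0 * z.2.1 (fun _ => e i0) i1 * z.2.2.1 ![e i2, e i2] i1;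
    let I6 : Jet3 → ℝ := fun z => ∑ i0 : Fin 3, ∑ i1 : Fin 3, ∑ i2 : Fin 3, z.1 i0 * z.2.1 (fun _ => e i0) i1 * z.2.2.1 ![e i1, e i2] i2;
    let I7 : Jet3 → ℝ := fun z => ∑ i0 : Fin 3, ∑ i1 : Fin 3, ∑ i2 : Fin 3, z.1 i0 * z.2.1 (fun _ => e i1) i1 * z.2.2.1 ![e i2, e i2] i0;
    let I8 : Jet3 → ℝ := fun z => ∑ i0 : Fin 3, ∑ i1 : Fin 3, ∑ i2 : Fin 3, z.1 i0 * z.2.1 (fun _ => e i2) i1 * z.2.2.1 ![e i1, e i2] i0;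
    let I9 : Jet3 → ℝ := fun z => ∑ i0 : Fin 3, ∑ i1 : Fin 3, ∑ i2 : Fin 3, z.1 i0 * z.2.1 (fun _ => e i1) i1 * z.2.2.1 ![e i0, e i2] i2;
    let I10 : Jet3 → ℝ := fun z => ∑ i0 : Fin 3, ∑ i1 : Fin 3, ∑ i2 : Fin 3, z.1 i0 * z.2.1 (fun _ => e i2) i1 * z.2.2.1 ![e i0, e i2] i1;
    let I11 : Jet3 → ℝ := fun z => ∑ i0 : Fin 3, ∑ i1 : Fin 3, ∑ i2 : Fin 3, z.1 i0 * z.2.1 (fun _ => e i2) i1 * z.2.2.1 ![e i0, e i1] i2;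
    let I12 : Jet3 → ℝ := fun z => ∑ i0 : Fin 3, ∑ i1 : Fin 3, ∑ i2 : Fin 3, z.2.1 (fun _ => e i0) i0 * z.2.1 (fun _ => e i1) i1 * z.2.1 (fun _ => e i2) i2;
    let I13 : Jet3 → ℝ := fun z => ∑ i0 : Fin 3, ∑ i1 : Fin 3, ∑ i2 : Fin 3, z.2.1 (fun _ => e i0) i0 * z.2.1 (fun _ => e i2) i1 * z.2.1 (fun _ => e i2) i1;
    let I14 : Jet3 → ℝ := fun z => ∑ i0 : Fin 3, ∑ i1 : Fin 3, ∑ i2 : Fin 3, z.2.1 (fun _ => e i0) i0 * z.2.1 (fun _ => e i2) i1 * z.2.1 (fun _ => e i1) i2;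
    let I15 : Jet3 → ℝ := fun z => ∑ i0 : Fin 3, ∑ i1 : Fin 3, ∑ i2 : Fin 3, z.2.1 (fun _ => e i1) i0 * z.2.1 (fun _ => e i2) i0 * z.2.1 (fun _ => e i2) i1;
    let I16 : Jet3 → ℝ := fun z => ∑ i0 : Fin 3, ∑ i1 : Fin 3, ∑ i2 : Fin 3, z.2.1 (fun _ => e i1) i0 * z.2.1 (fun _ => e i0) i2 * z.2.1 (fun _ => e i2) i1;
    let I : Fin 17 → Jet3 → ℝ := ![I0, I1, I2, I3, I4, I5, I6, I7, I8, I9, I10, I11, I12, I13, I14, I15, I16];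
    let α : Fin 17 → ℝ := ![0, -1, 0, 0, 0, 1, 0, 0, 1, 0, 0, 0, 0, 0, 0, -1, 0];
    let Symm : Jet3 → Prop := fun z =>
      (∀ (h : Fin 2 → E3) (σ : Equiv.Perm (Fin 2)), z.2.2.1 (h ∘ σ) = z.2.2.1 h) ∧
      (∀ (h : Fin 3 → E3) (σ : Equiv.Perm (Fin 3)), z.2.2.2 (h ∘ σ) = z.2.2.2 h);
    let J := fun (v : E3 → E3) (x : E3) => ((v x, iteratedFDeriv ℝ 1 v x, iteratedFDeriv ℝ 2 v x, iteratedFDeriv ℝ 3 v x) : Jet3);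
    ∀ (m : Jet3 → ℝ), ContDiff ℝ (⊤ : ℕ∞) m → (∀ (μ : ℝ) z, m (μ • z) = μ ^ 3 * m z) →
      (∀ (s : ℝ), 0 < s → ∀ (z₀ : E3) (z₁ : E3 [×1]→L[ℝ] E3) (z₂ : E3 [×2]→L[ℝ] E3) (z₃ : E3 [×3]→L[ℝ] E3),
          m (z₀, s • z₁, (s ^ 2) • z₂, (s ^ 3) • z₃) = s ^ 3 * m (z₀, z₁, z₂, z₃)) →
      (∀ (g : E3 ≃ₗᵢ[ℝ] E3) (z : Jet3), m (jetAct g z) = m z) →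
      ∃ d : Fin 17 → ℝ, ∀ z : Jet3, Symm z → m z = ∑ l : Fin 17, d l * I l z :=
  Theorems.stub_isoStructureThree

/-- **stub — `stub_isoNullThree` (L; lead, generated certificates). Null Lagrangians at weight 3.** Each of the 17
contractions differs from `α_l · r` (`r = ω·(∇u)ω`, `α = (0,−1,0,0,0,1,0,0,1,0,0,0,0,0,0,−1,0)`) by a density that is a
total divergence on divergence-free jets (explicit cubic weight-2 fluxes from the exact engine), hence has vanishing
Euler derivative on divergence-free Schwartz fields (`stub_nullTransfer`, `stub_jetCalculus`). -/
theorem stub_isoNullThree :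
    let e : Fin 3 → E3 := fun i => EuclideanSpace.single i (1 : ℝ);
    let ω : (E3 [×1]→L[ℝ] E3) → E3 := fun A =>
      WithLp.toLp 2 ![A (fun _ => e 1) 2 - A (fun _ => e 2) 1, A (fun _ => e 2) 0 - A (fun _ => e 0) 2,
        A (fun _ => e 0) 1 - A (fun _ => e 1) 0];
    let r : Jet3 → ℝ := fun z => inner ℝ (ω z.2.1) (z.2.1 (fun _ => ω z.2.1));
    let I0 : Jet3 → ℝ := fun z => ∑ i0 : Fin 3, ∑ i1 : Fin 3, ∑ i2 : Fin 3, z.1 i0 * z.1 i0 * z.2.2.2 ![e i1, e i2, e i2] i1;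
    let I1 : Jet3 → ℝ := fun z => ∑ i0 : Fin 3, ∑ i1 : Fin 3, ∑ i2 : Fin 3, z.1 i0 * z.1 i1 * z.2.2.2 ![e i1, e i2, e i2] i0;
    let I2 : Jet3 → ℝ := fun z => ∑ i0 : Fin 3, ∑ i1 : Fin 3, ∑ i2 : Fin 3, z.1 i0 * z.1 i1 * z.2.2.2 ![e i0, e i1, e i2] i2;
    let I3 : Jet3 → ℝ := fun z => ∑ i0 : Fin 3, ∑ i1 : Fin 3, ∑ i2 : Fin 3, z.1 i0 * z.2.1 (fun _ => e i1) i0 * z.2.2.1 ![e i2, e i2] i1;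
    let I4 : Jet3 → ℝ := fun z => ∑ i0 : Fin 3, ∑ i1 : Fin 3, ∑ i2 : Fin 3, z.1 i0 * z.2.1 (fun _ => e i1) i0 * z.2.2.1 ![e i1, e i2] i2;
    let I5 : Jet3 → ℝ := fun z => ∑ i0 : Fin 3, ∑ i1 : Fin 3, ∑ i2 : Fin 3, z.1 i0 * z.2.1 (fun _ => e i0) i1 * z.2.2.1 ![e i2, e i2] i1;
    let I6 : Jet3 → ℝ := fun z => ∑ i0 : Fin 3, ∑ i1 : Fin 3, ∑ i2 : Fin 3, z.1 i0 * z.2.1 (fun _ => e i0) i1 * z.2.2.1 ![e i1, e i2] i2;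
    let I7 : Jet3 → ℝ := fun z => ∑ i0 : Fin 3, ∑ i1 : Fin 3, ∑ i2 : Fin 3, z.1 i0 * z.2.1 (fun _ => e i1) i1 * z.2.2.1 ![e i2, e i2] i0;
    let I8 : Jet3 → ℝ := fun z => ∑ i0 : Fin 3, ∑ i1 : Fin 3, ∑ i2 : Fin 3, z.1 i0 * z.2.1 (fun _ => e i2) i1 * z.2.2.1 ![e i1, e i2] i0;
    let I9 : Jet3 → ℝ := fun z => ∑ i0 : Fin 3, ∑ i1 : Fin 3, ∑ i2 : Fin 3, z.1 i0 * z.2.1 (fun _ => e i1) i1 * z.2.2.1 ![e i0, e i2] i2;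
    let I10 : Jet3 → ℝ := fun z => ∑ i0 : Fin 3, ∑ i1 : Fin 3, ∑ i2 : Fin 3, z.1 i0 * z.2.1 (fun _ => e i2) i1 * z.2.2.1 ![e i0, e i2] i1;
    let I11 : Jet3 → ℝ := fun z => ∑ i0 : Fin 3, ∑ i1 : Fin 3, ∑ i2 : Fin 3, z.1 i0 * z.2.1 (fun _ => e i2) i1 * z.2.2.1 ![e i0, e i1] i2;
    let I12 : Jet3 → ℝ := fun z => ∑ i0 : Fin 3, ∑ i1 : Fin 3, ∑ i2 : Fin 3, z.2.1 (fun _ => e i0) i0 * z.2.1 (fun _ => e i1) i1 * z.2.1 (fun _ => e i2) i2;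
    let I13 : Jet3 → ℝ := fun z => ∑ i0 : Fin 3, ∑ i1 : Fin 3, ∑ i2 : Fin 3, z.2.1 (fun _ => e i0) i0 * z.2.1 (fun _ => e i2) i1 * z.2.1 (fun _ => e i2) i1;
    let I14 : Jet3 → ℝ := fun z => ∑ i0 : Fin 3, ∑ i1 : Fin 3, ∑ i2 : Fin 3, z.2.1 (fun _ => e i0) i0 * z.2.1 (fun _ => e i2) i1 * z.2.1 (fun _ => e i1) i2;
    let I15 : Jet3 → ℝ := fun z => ∑ i0 : Fin 3, ∑ i1 : Fin 3, ∑ i2 : Fin 3, z.2.1 (fun _ => e i1) i0 * z.2.1 (fun _ => e i2) i0 * z.2.1 (fun _ => e i2) i1;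
    let I16 : Jet3 → ℝ := fun z => ∑ i0 : Fin 3, ∑ i1 : Fin 3, ∑ i2 : Fin 3, z.2.1 (fun _ => e i1) i0 * z.2.1 (fun _ => e i0) i2 * z.2.1 (fun _ => e i2) i1;
    let I : Fin 17 → Jet3 → ℝ := ![I0, I1, I2, I3, I4, I5, I6, I7, I8, I9, I10, I11, I12, I13, I14, I15, I16];
    let α : Fin 17 → ℝ := ![0, -1, 0, 0, 0, 1, 0, 0, 1, 0, 0, 0, 0, 0, 0, -1, 0];
    let Symm : Jet3 → Prop := fun z =>
      (∀ (h : Fin 2 → E3) (σ : Equiv.Perm (Fin 2)), z.2.2.1 (h ∘ σ) = z.2.2.1 h) ∧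
      (∀ (h : Fin 3 → E3) (σ : Equiv.Perm (Fin 3)), z.2.2.2 (h ∘ σ) = z.2.2.2 h);
    let J := fun (v : E3 → E3) (x : E3) => ((v x, iteratedFDeriv ℝ 1 v x, iteratedFDeriv ℝ 2 v x, iteratedFDeriv ℝ 3 v x) : Jet3);
    (∀ l : Fin 17, ContDiff ℝ 1 (I l)) ∧
    ∀ (l : Fin 17) (v : E3 → E3), Literature.Analysis.FluidPDE.IsSchwartzField v →
      Literature.Analysis.FluidPDE.VectorCalculus.IsDivFree v →
      ∫ x, fderiv ℝ (fun z => I l z - α l * r z) (J v x) (J (Literature.Analysis.FluidPDE.eulerBilinear v v) x) = 0 :=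
  Theorems.stub_isoNullThree

/-- **stub — `stub_isoAssembleThree` (M/L; worker). The weight-3 endgame.** Given the structure of an invariant
weight-3 density on symmetric jets (`stub_isoStructureThree`), the nullity of `I_l − α_l r` (`stub_isoNullThree`) and
smoothness of the `I_l`, an `O(3)`-invariant Morawetz certificate of weight 3 is contradictory: its Euler derivative is
`(∑ d_l α_l) · Q_r`, and `Q_r` takes both signs (`stub_orderThreeLive`), so `Q ≡ 0`, contradicting strictness. -/
theorem stub_isoAssembleThree :
    let e : Fin 3 → E3 := fun i => EuclideanSpace.single i (1 : ℝ);
    let ω : (E3 [×1]→L[ℝ] E3) → E3 := fun A =>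
      WithLp.toLp 2 ![A (fun _ => e 1) 2 - A (fun _ => e 2) 1, A (fun _ => e 2) 0 - A (fun _ => e 0) 2,
        A (fun _ => e 0) 1 - A (fun _ => e 1) 0];
    let r : Jet3 → ℝ := fun z => inner ℝ (ω z.2.1) (z.2.1 (fun _ => ω z.2.1));
    let I0 : Jet3 → ℝ := fun z => ∑ i0 : Fin 3, ∑ i1 : Fin 3, ∑ i2 : Fin 3, z.1 i0 * z.1 i0 * z.2.2.2 ![e i1, e i2, e i2] i1;
    let I1 : Jet3 → ℝ := fun z => ∑ i0 : Fin 3, ∑ i1 : Fin 3, ∑ i2 : Fin 3, z.1 i0 * z.1 i1 * z.2.2.2 ![e i1, e i2, e i2] i0;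
    let I2 : Jet3 → ℝ := fun z => ∑ i0 : Fin 3, ∑ i1 : Fin 3, ∑ i2 : Fin 3, z.1 i0 * z.1 i1 * z.2.2.2 ![e i0, e i1, e i2] i2;
    let I3 : Jet3 → ℝ := fun z => ∑ i0 : Fin 3, ∑ i1 : Fin 3, ∑ i2 : Fin 3, z.1 i0 * z.2.1 (fun _ => e i1) i0 * z.2.2.1 ![e i2, e i2] i1;
    let I4 : Jet3 → ℝ := fun z => ∑ i0 : Fin 3, ∑ i1 : Fin 3, ∑ i2 : Fin 3, z.1 i0 * z.2.1 (fun _ => e i1) i0 * z.2.2.1 ![e i1, e i2] i2;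
    let I5 : Jet3 → ℝ := fun z => ∑ i0 : Fin 3, ∑ i1 : Fin 3, ∑ i2 : Fin 3, z.1 i0 * z.2.1 (fun _ => e i0) i1 * z.2.2.1 ![e i2, e i2] i1;
    let I6 : Jet3 → ℝ := fun z => ∑ i0 : Fin 3, ∑ i1 : Fin 3, ∑ i2 : Fin 3, z.1 i0 * z.2.1 (fun _ => e i0) i1 * z.2.2.1 ![e i1, e i2] i2;
    let I7 : Jet3 → ℝ := fun z => ∑ i0 : Fin 3, ∑ i1 : Fin 3, ∑ i2 : Fin 3, z.1 i0 * z.2.1 (fun _ => e i1) i1 * z.2.2.1 ![e i2, e i2] i0;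
    let I8 : Jet3 → ℝ := fun z => ∑ i0 : Fin 3, ∑ i1 : Fin 3, ∑ i2 : Fin 3, z.1 i0 * z.2.1 (fun _ => e i2) i1 * z.2.2.1 ![e i1, e i2] i0;
    let I9 : Jet3 → ℝ := fun z => ∑ i0 : Fin 3, ∑ i1 : Fin 3, ∑ i2 : Fin 3, z.1 i0 * z.2.1 (fun _ => e i1) i1 * z.2.2.1 ![e i0, e i2] i2;
    let I10 : Jet3 → ℝ := fun z => ∑ i0 : Fin 3, ∑ i1 : Fin 3, ∑ i2 : Fin 3, z.1 i0 * z.2.1 (fun _ => e i2) i1 * z.2.2.1 ![e i0, e i2] i1;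
    let I11 : Jet3 → ℝ := fun z => ∑ i0 : Fin 3, ∑ i1 : Fin 3, ∑ i2 : Fin 3, z.1 i0 * z.2.1 (fun _ => e i2) i1 * z.2.2.1 ![e i0, e i1] i2;
    let I12 : Jet3 → ℝ := fun z => ∑ i0 : Fin 3, ∑ i1 : Fin 3, ∑ i2 : Fin 3, z.2.1 (fun _ => e i0) i0 * z.2.1 (fun _ => e i1) i1 * z.2.1 (fun _ => e i2) i2;
    let I13 : Jet3 → ℝ := fun z => ∑ i0 : Fin 3, ∑ i1 : Fin 3, ∑ i2 : Fin 3, z.2.1 (fun _ => e i0) i0 * z.2.1 (fun _ => e i2) i1 * z.2.1 (fun _ => e i2) i1;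
    let I14 : Jet3 → ℝ := fun z => ∑ i0 : Fin 3, ∑ i1 : Fin 3, ∑ i2 : Fin 3, z.2.1 (fun _ => e i0) i0 * z.2.1 (fun _ => e i2) i1 * z.2.1 (fun _ => e i1) i2;
    let I15 : Jet3 → ℝ := fun z => ∑ i0 : Fin 3, ∑ i1 : Fin 3, ∑ i2 : Fin 3, z.2.1 (fun _ => e i1) i0 * z.2.1 (fun _ => e i2) i0 * z.2.1 (fun _ => e i2) i1;
    let I16 : Jet3 → ℝ := fun z => ∑ i0 : Fin 3, ∑ i1 : Fin 3, ∑ i2 : Fin 3, z.2.1 (fun _ => e i1) i0 * z.2.1 (fun _ => e i0) i2 * z.2.1 (fun _ => e i2) i1;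
    let I : Fin 17 → Jet3 → ℝ := ![I0, I1, I2, I3, I4, I5, I6, I7, I8, I9, I10, I11, I12, I13, I14, I15, I16];
    let α : Fin 17 → ℝ := ![0, -1, 0, 0, 0, 1, 0, 0, 1, 0, 0, 0, 0, 0, 0, -1, 0];
    let Symm : Jet3 → Prop := fun z =>
      (∀ (h : Fin 2 → E3) (σ : Equiv.Perm (Fin 2)), z.2.2.1 (h ∘ σ) = z.2.2.1 h) ∧
      (∀ (h : Fin 3 → E3) (σ : Equiv.Perm (Fin 3)), z.2.2.2 (h ∘ σ) = z.2.2.2 h);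
    let J := fun (v : E3 → E3) (x : E3) => ((v x, iteratedFDeriv ℝ 1 v x, iteratedFDeriv ℝ 2 v x, iteratedFDeriv ℝ 3 v x) : Jet3);
    let Q := fun (m : Jet3 → ℝ) (v : E3 → E3) =>
      -∫ x, fderiv ℝ m (J v x) (J (Literature.Analysis.FluidPDE.eulerBilinear v v) x);
    ∀ (m : Jet3 → ℝ), ContDiff ℝ (⊤ : ℕ∞) m →
      (∀ v, Literature.Analysis.FluidPDE.IsSchwartzField v →
          Literature.Analysis.FluidPDE.VectorCalculus.IsDivFree v → 0 ≤ Q m v) →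
      (∃ v, Literature.Analysis.FluidPDE.IsSchwartzField v ∧
          Literature.Analysis.FluidPDE.VectorCalculus.IsDivFree v ∧ 0 < Q m v) →
      (∃ d : Fin 17 → ℝ, ∀ z : Jet3, Symm z → m z = ∑ l : Fin 17, d l * I l z) →
      (∀ (l : Fin 17) (v : E3 → E3), Literature.Analysis.FluidPDE.IsSchwartzField v →
          Literature.Analysis.FluidPDE.VectorCalculus.IsDivFree v →
          ∫ x, fderiv ℝ (fun z => I l z - α l * r z) (J v x) (J (Literature.Analysis.FluidPDE.eulerBilinear v v) x) = 0) →
      (∀ l : Fin 17, ContDiff ℝ 1 (I l)) → ContDiff ℝ 1 r → False :=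
  Theorems.stub_isoAssembleThree



/-- **stub — `stub_kitSums` (M; worker). Generic algebra for the structure theorems, I.** (K1) slotwise finite sums of a
trilinear form on jets; (K2)/(K3) folding of symmetric double/triple sums over `Fin n` into ordered index ranges; (K4) linearity
of the pure-jet embeddings; (K8) the infinitesimal generator `ℓ` of `stub_infinitesimalInvariance` (for any linear `L`) on pure
jets; (K9) matrix entries of `Matrix.toEuclideanCLM`; (K10) sums over `Fin n → Fin 3` as iterated sums. -/
theorem stub_kitSums :
    let e : Fin 3 → E3 := fun i => EuclideanSpace.single i (1 : ℝ);
    (∀ (T : Jet3 [×3]→L[ℝ] ℝ) {ι : Type} (s : Finset ι) (x : ι → Jet3) (y w : Jet3),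
      T ![∑ i ∈ s, x i, y, w] = ∑ i ∈ s, T ![x i, y, w] ∧ T ![y, ∑ i ∈ s, x i, w] = ∑ i ∈ s, T ![y, x i, w] ∧
        T ![y, w, ∑ i ∈ s, x i] = ∑ i ∈ s, T ![y, w, x i]) ∧
    (∀ (n : ℕ) (g : Fin n → Fin n → ℝ), (∀ a b, g a b = g b a) →
      ∑ a, ∑ b, g a b = ∑ a, g a a + 2 * ∑ a, ∑ b, if a < b then g a b else 0) ∧
    (∀ (n : ℕ) (g : Fin n → Fin n → Fin n → ℝ), (∀ a b c, g a b c = g b a c) → (∀ a b c, g a b c = g a c b) →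
      ∑ a, ∑ b, ∑ c, g a b c = ∑ a, g a a a + 3 * (∑ a, ∑ b, if a < b then g a a b + g a b b else 0) +
        6 * ∑ a, ∑ b, ∑ c, if a < b ∧ b < c then g a b c else 0) ∧
    (∀ {ι : Type} (s : Finset ι) (c : ι → ℝ),
      (∀ (X : ι → E3), (((∑ i ∈ s, c i • X i), 0, 0, 0) : Jet3) = ∑ i ∈ s, c i • ((X i, 0, 0, 0) : Jet3)) ∧
      (∀ (X : ι → E3 [×1]→L[ℝ] E3), ((0, (∑ i ∈ s, c i • X i), 0, 0) : Jet3) = ∑ i ∈ s, c i • ((0, X i, 0, 0) : Jet3)) ∧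
      (∀ (X : ι → E3 [×2]→L[ℝ] E3), ((0, 0, (∑ i ∈ s, c i • X i), 0) : Jet3) = ∑ i ∈ s, c i • ((0, 0, X i, 0) : Jet3)) ∧
      (∀ (X : ι → E3 [×3]→L[ℝ] E3), ((0, 0, 0, (∑ i ∈ s, c i • X i)) : Jet3) = ∑ i ∈ s, c i • ((0, 0, 0, X i) : Jet3))) ∧
    (∀ (L : E3 →L[ℝ] E3),
      let ℓ : Jet3 → Jet3 := fun z =>
        (L z.1,
          L.compContinuousMultilinearMap z.2.1 -
            ∑ s : Fin 1, z.2.1.compContinuousLinearMap (Function.update (fun _ => ContinuousLinearMap.id ℝ E3) s L),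
          L.compContinuousMultilinearMap z.2.2.1 -
            ∑ s : Fin 2, z.2.2.1.compContinuousLinearMap (Function.update (fun _ => ContinuousLinearMap.id ℝ E3) s L),
          L.compContinuousMultilinearMap z.2.2.2 -
            ∑ s : Fin 3, z.2.2.2.compContinuousLinearMap (Function.update (fun _ => ContinuousLinearMap.id ℝ E3) s L));
      (∀ x : E3, ℓ ((x, 0, 0, 0) : Jet3) = ((L x, 0, 0, 0) : Jet3)) ∧
      (∀ X : E3 [×1]→L[ℝ] E3, ℓ ((0, X, 0, 0) : Jet3) = ((0, L.compContinuousMultilinearMap X -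
            ∑ s : Fin 1, X.compContinuousLinearMap (Function.update (fun _ => ContinuousLinearMap.id ℝ E3) s L), 0, 0) : Jet3)) ∧
      (∀ X : E3 [×2]→L[ℝ] E3, ℓ ((0, 0, X, 0) : Jet3) = ((0, 0, L.compContinuousMultilinearMap X -
            ∑ s : Fin 2, X.compContinuousLinearMap (Function.update (fun _ => ContinuousLinearMap.id ℝ E3) s L), 0) : Jet3)) ∧
      (∀ X : E3 [×3]→L[ℝ] E3, ℓ ((0, 0, 0, X) : Jet3) = ((0, 0, 0, L.compContinuousMultilinearMap X -
            ∑ s : Fin 3, X.compContinuousLinearMap (Function.update (fun _ => ContinuousLinearMap.id ℝ E3) s L)) : Jet3))) ∧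
    (∀ (M : Matrix (Fin 3) (Fin 3) ℝ) (i j : Fin 3),
      Matrix.toEuclideanCLM (n := Fin 3) (𝕜 := ℝ) M (EuclideanSpace.single j (1 : ℝ)) i = M i j) ∧
    (∀ {M : Type} [AddCommMonoid M],
      (∀ f : (Fin 1 → Fin 3) → M, ∑ J, f J = ∑ j : Fin 3, f ![j]) ∧
      (∀ f : (Fin 2 → Fin 3) → M, ∑ J, f J = ∑ j₀ : Fin 3, ∑ j₁ : Fin 3, f ![j₀, j₁]) ∧
      (∀ f : (Fin 3 → Fin 3) → M, ∑ J, f J = ∑ j₀ : Fin 3, ∑ j₁ : Fin 3, ∑ j₂ : Fin 3, f ![j₀, j₁, j₂])) :=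
  Theorems.stub_kitSums

/-- **stub — `stub_kitSign` (M; worker). The hyperoctahedral SIGN rule.** For an isometry-invariant trilinear form `T` on
3-jets and the symmetrised basis maps `jbsum` (landed `OddMorawetzMorawetzKillsTypeIJetCoordDefs`; their transformation under
signed permutations is the hypothesis `hS` = `stub_symBasis` (L3)), a coefficient `T(X, Y, W)` on pure basis jets vanishes as soon
as some index value `v ∈ {0,1,2}` occurs an odd number of times among all indices (flip the sign of `e_v`): blocks u u T, u A H,
A A A (weight 3) and u H T, A A T, A H H (weight 5). -/
theorem stub_kitSign :
    let e : Fin 3 → E3 := fun i => EuclideanSpace.single i (1 : ℝ);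
    ∀ (T : Jet3 [×3]→L[ℝ] ℝ),
      (∀ (g : E3 ≃ₗᵢ[ℝ] E3) (x : Fin 3 → Jet3), T (fun s => jetAct g (x s)) = T x) →
      (∀ (σ : Equiv.Perm (Fin 3)) (ε : Fin 3 → ℤˣ) (n : ℕ) (c : Fin 3) (J : Fin n → Fin 3),
        mlAct (signedPerm σ ε) n (jbsum n c J) =
          (((ε (σ c) : ℤ) : ℝ) * ∏ s, ((ε (σ (J s)) : ℤ) : ℝ)) • jbsum n (σ c) (σ ∘ J)) →
      (∀ (a a' c : Fin 3) (J : Fin 3 → Fin 3), (∃ v : Fin 3, Odd ((a :: a' :: c :: List.ofFn J).count v)) →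
        T ![((e a, 0, 0, 0) : Jet3), ((e a', 0, 0, 0) : Jet3), ((0, 0, 0, jbsum 3 c J) : Jet3)] = 0) ∧
      (∀ (a c₁ : Fin 3) (J₁ : Fin 1 → Fin 3) (c₂ : Fin 3) (J₂ : Fin 2 → Fin 3),
        (∃ v : Fin 3, Odd ((a :: c₁ :: c₂ :: (List.ofFn J₁ ++ List.ofFn J₂)).count v)) →
        T ![((e a, 0, 0, 0) : Jet3), ((0, jbsum 1 c₁ J₁, 0, 0) : Jet3), ((0, 0, jbsum 2 c₂ J₂, 0) : Jet3)] = 0) ∧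
      (∀ (c₁ : Fin 3) (J₁ : Fin 1 → Fin 3) (c₂ : Fin 3) (J₂ : Fin 1 → Fin 3) (c₃ : Fin 3) (J₃ : Fin 1 → Fin 3),
        (∃ v : Fin 3, Odd ((c₁ :: c₂ :: c₃ :: (List.ofFn J₁ ++ List.ofFn J₂ ++ List.ofFn J₃)).count v)) →
        T ![((0, jbsum 1 c₁ J₁, 0, 0) : Jet3), ((0, jbsum 1 c₂ J₂, 0, 0) : Jet3), ((0, jbsum 1 c₃ J₃, 0, 0) : Jet3)] = 0) ∧
      (∀ (a c₂ : Fin 3) (J₂ : Fin 2 → Fin 3) (c₃ : Fin 3) (J₃ : Fin 3 → Fin 3),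
        (∃ v : Fin 3, Odd ((a :: c₂ :: c₃ :: (List.ofFn J₂ ++ List.ofFn J₃)).count v)) →
        T ![((e a, 0, 0, 0) : Jet3), ((0, 0, jbsum 2 c₂ J₂, 0) : Jet3), ((0, 0, 0, jbsum 3 c₃ J₃) : Jet3)] = 0) ∧
      (∀ (c₁ : Fin 3) (J₁ : Fin 1 → Fin 3) (c₂ : Fin 3) (J₂ : Fin 1 → Fin 3) (c₃ : Fin 3) (J₃ : Fin 3 → Fin 3),
        (∃ v : Fin 3, Odd ((c₁ :: c₂ :: c₃ :: (List.ofFn J₁ ++ List.ofFn J₂ ++ List.ofFn J₃)).count v)) →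
        T ![((0, jbsum 1 c₁ J₁, 0, 0) : Jet3), ((0, jbsum 1 c₂ J₂, 0, 0) : Jet3), ((0, 0, 0, jbsum 3 c₃ J₃) : Jet3)] = 0) ∧
      (∀ (c₁ : Fin 3) (J₁ : Fin 1 → Fin 3) (c₂ : Fin 3) (J₂ : Fin 2 → Fin 3) (c₃ : Fin 3) (J₃ : Fin 2 → Fin 3),
        (∃ v : Fin 3, Odd ((c₁ :: c₂ :: c₃ :: (List.ofFn J₁ ++ List.ofFn J₂ ++ List.ofFn J₃)).count v)) →
        T ![((0, jbsum 1 c₁ J₁, 0, 0) : Jet3), ((0, 0, jbsum 2 c₂ J₂, 0) : Jet3), ((0, 0, jbsum 2 c₃ J₃, 0) : Jet3)] = 0) :=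
  Theorems.stub_kitSign

/-- **stub — `stub_kitPerm` (M; worker). The index-RELABELLING rule.** For an isometry-invariant trilinear form `T` on 3-jets,
relabelling all indices of a coefficient `T(X, Y, W)` on pure basis jets by a permutation `σ ∈ 𝔖₃` (the coordinate permutation
isometry) does not change it: blocks u u T, u A H, A A A (weight 3) and u H T, A A T, A H H (weight 5). (Uses `stub_symBasis` (L3)
with trivial signs, landed as `mlAct_signedPerm_basis` summed over orderings, or prove the `ε = 1` case directly.) -/
theorem stub_kitPerm :
    let e : Fin 3 → E3 := fun i => EuclideanSpace.single i (1 : ℝ);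
    ∀ (T : Jet3 [×3]→L[ℝ] ℝ),
      (∀ (g : E3 ≃ₗᵢ[ℝ] E3) (x : Fin 3 → Jet3), T (fun s => jetAct g (x s)) = T x) →
      (∀ (σ : Equiv.Perm (Fin 3)) (a a' c : Fin 3) (J : Fin 3 → Fin 3),
        T ![((e (σ a), 0, 0, 0) : Jet3), ((e (σ a'), 0, 0, 0) : Jet3), ((0, 0, 0, jbsum 3 (σ c) (σ ∘ J)) : Jet3)] =
          T ![((e a, 0, 0, 0) : Jet3), ((e a', 0, 0, 0) : Jet3), ((0, 0, 0, jbsum 3 c J) : Jet3)]) ∧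
      (∀ (σ : Equiv.Perm (Fin 3)) (a c₁ : Fin 3) (J₁ : Fin 1 → Fin 3) (c₂ : Fin 3) (J₂ : Fin 2 → Fin 3),
        T ![((e (σ a), 0, 0, 0) : Jet3), ((0, jbsum 1 (σ c₁) (σ ∘ J₁), 0, 0) : Jet3), ((0, 0, jbsum 2 (σ c₂) (σ ∘ J₂), 0) : Jet3)] =
          T ![((e a, 0, 0, 0) : Jet3), ((0, jbsum 1 c₁ J₁, 0, 0) : Jet3), ((0, 0, jbsum 2 c₂ J₂, 0) : Jet3)]) ∧
      (∀ (σ : Equiv.Perm (Fin 3)) (c₁ : Fin 3) (J₁ : Fin 1 → Fin 3) (c₂ : Fin 3) (J₂ : Fin 1 → Fin 3) (c₃ : Fin 3) (J₃ : Fin 1 → Fin 3),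
        T ![((0, jbsum 1 (σ c₁) (σ ∘ J₁), 0, 0) : Jet3), ((0, jbsum 1 (σ c₂) (σ ∘ J₂), 0, 0) : Jet3), ((0, jbsum 1 (σ c₃) (σ ∘ J₃), 0, 0) : Jet3)] =
          T ![((0, jbsum 1 c₁ J₁, 0, 0) : Jet3), ((0, jbsum 1 c₂ J₂, 0, 0) : Jet3), ((0, jbsum 1 c₃ J₃, 0, 0) : Jet3)]) ∧
      (∀ (σ : Equiv.Perm (Fin 3)) (a c₂ : Fin 3) (J₂ : Fin 2 → Fin 3) (c₃ : Fin 3) (J₃ : Fin 3 → Fin 3),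
        T ![((e (σ a), 0, 0, 0) : Jet3), ((0, 0, jbsum 2 (σ c₂) (σ ∘ J₂), 0) : Jet3), ((0, 0, 0, jbsum 3 (σ c₃) (σ ∘ J₃)) : Jet3)] =
          T ![((e a, 0, 0, 0) : Jet3), ((0, 0, jbsum 2 c₂ J₂, 0) : Jet3), ((0, 0, 0, jbsum 3 c₃ J₃) : Jet3)]) ∧
      (∀ (σ : Equiv.Perm (Fin 3)) (c₁ : Fin 3) (J₁ : Fin 1 → Fin 3) (c₂ : Fin 3) (J₂ : Fin 1 → Fin 3) (c₃ : Fin 3) (J₃ : Fin 3 → Fin 3),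
        T ![((0, jbsum 1 (σ c₁) (σ ∘ J₁), 0, 0) : Jet3), ((0, jbsum 1 (σ c₂) (σ ∘ J₂), 0, 0) : Jet3), ((0, 0, 0, jbsum 3 (σ c₃) (σ ∘ J₃)) : Jet3)] =
          T ![((0, jbsum 1 c₁ J₁, 0, 0) : Jet3), ((0, jbsum 1 c₂ J₂, 0, 0) : Jet3), ((0, 0, 0, jbsum 3 c₃ J₃) : Jet3)]) ∧
      (∀ (σ : Equiv.Perm (Fin 3)) (c₁ : Fin 3) (J₁ : Fin 1 → Fin 3) (c₂ : Fin 3) (J₂ : Fin 2 → Fin 3) (c₃ : Fin 3) (J₃ : Fin 2 → Fin 3),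
        T ![((0, jbsum 1 (σ c₁) (σ ∘ J₁), 0, 0) : Jet3), ((0, 0, jbsum 2 (σ c₂) (σ ∘ J₂), 0) : Jet3), ((0, 0, jbsum 2 (σ c₃) (σ ∘ J₃), 0) : Jet3)] =
          T ![((0, jbsum 1 c₁ J₁, 0, 0) : Jet3), ((0, 0, jbsum 2 c₂ J₂, 0) : Jet3), ((0, 0, jbsum 2 c₃ J₃, 0) : Jet3)]) :=
  Theorems.stub_kitPerm


/-! ### Closed glue: the weight split -/

/-- **`stub_isoWeight` (the composition's second stub) — CLOSED modulo `stub_isoStructureThree`, `stub_isoNullThree`,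
`stub_isoAssembleThree` (k = 3) and `stub_isoWeightFive` (k = 5).** -/
theorem stub_isoWeight :
    ∀ (k : ℕ) (m : Jet3 → ℝ),
      let J := fun (v : E3 → E3) (x : E3) => ((v x, iteratedFDeriv ℝ 1 v x, iteratedFDeriv ℝ 2 v x, iteratedFDeriv ℝ 3 v x) : Jet3);
      let Q := fun (m : Jet3 → ℝ) (v : E3 → E3) =>
        -∫ x, fderiv ℝ m (J v x) (J (Literature.Analysis.FluidPDE.eulerBilinear v v) x);
      (k = 3 ∨ k = 5) → ContDiff ℝ (⊤ : ℕ∞) m → (∀ (μ : ℝ) z, m (μ • z) = μ ^ 3 * m z) →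
      (∀ (s : ℝ), 0 < s → ∀ (z₀ : E3) (z₁ : E3 [×1]→L[ℝ] E3) (z₂ : E3 [×2]→L[ℝ] E3) (z₃ : E3 [×3]→L[ℝ] E3),
          m (z₀, s • z₁, (s ^ 2) • z₂, (s ^ 3) • z₃) = s ^ k * m (z₀, z₁, z₂, z₃)) →
      (∀ (g : E3 ≃ₗᵢ[ℝ] E3) (z : Jet3), m (jetAct g z) = m z) →
      (∀ v, Literature.Analysis.FluidPDE.IsSchwartzField v →
          Literature.Analysis.FluidPDE.VectorCalculus.IsDivFree v → 0 ≤ Q m v) →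
      (∃ v, Literature.Analysis.FluidPDE.IsSchwartzField v ∧
          Literature.Analysis.FluidPDE.VectorCalculus.IsDivFree v ∧ 0 < Q m v) → False := by
  intro k m J Q hk hm hcub hwt hinv hQ hpos
  rcases hk with rfl | rfl
  · have hS := stub_isoStructureThree m hm hcub hwt hinv
    exact stub_isoAssembleThree m hm hQ hpos hS (stub_isoNullThree).2 (stub_isoNullThree).1
      ((stub_orderThreeLive).1.of_le (by exact_mod_cast le_top))
  · exact stub_isoWeightFive m hm hcub hwt hinv hQ hpos

/-! ### Composition -/

/-- **The crux from the two top stubs.** By the landed reduction `morawetzKillsTypeI_of_no_certificate_ge_three`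
(even weights by parity, weight one by hyperoctahedral averaging) it suffices to refute a certificate of odd weight
`3 ≤ k ≤ 5`, i.e. `k ∈ {3, 5}`; average it over `O(3)` (`stub_isotropicReduction`) and refute the invariant certificate
(`stub_isoWeight`). Closed modulo the stubs. -/
theorem MorawetzKillsTypeI_of :
    Summit.NavierStokesRegularity.NavierStokesRegularity.Theses.OddMorawetz.MorawetzKillsTypeI := by
  refine Summit.NavierStokesRegularity.NavierStokesRegularity.Theorems.morawetzKillsTypeI_of_no_certificate_ge_three ?_
  intro k m J Q h3 h5 hodd hm hcub hwt hQ hpos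
  have hk : k = 3 ∨ k = 5 := by
    rcases hodd with ⟨j, rfl⟩
    omega
  obtain ⟨m', hm', hcub', hwt', hinv', hQ', hpos'⟩ := stub_isotropicReduction k m hm hcub hwt hQ hpos
  exact stub_isoWeight k m' hk hm' hcub' hwt' hinv' hQ' hpos'

/-- `MorawetzKillsTypeI` BY NAME (the form the gate checks), modulo the stubs. -/
theorem MorawetzKillsTypeI_proof : Theses.OddMorawetz.MorawetzKillsTypeI := MorawetzKillsTypeI_of

end Summit.NavierStokesRegularity.NavierStokesRegularity.Cruxes.MorawetzKillsTypeI.Birth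

end
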